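import Summits.QuantumFields.YangMills.Theorems.FlatTubeReductionFibredBOBlocks
import HarnessLib

/-!
# Fibred Born–Oppenheimer blocks by Cauchy–Schwarz in the kinetic Gram form — part 2: the CROSS block (P4) and exact orthogonality (P1)
# (route `FlatTubeReduction`, crux K1 `NearFlatRatioLaw` stmt-QuantumFields-24720, registered stub `stub_boRate` = FCL 23943's `BORateAll`;
# rung R2b1 = RECORD-label femto gap; no summit statement is proved here)

Seat `ym-line-ftr-p1` g6 (prover).  Sequel of `…FlatTubeReductionFibredBOBlocks` (objects `halfT`, `fibrePair`, `fibreEnergy`, `fibredForm`; MASTER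
inequality, DIAGONAL and STIFF blocks).  Here, for the fibred model `T(Φ,Ψ) = ∫∫ k(c,c')·B_{c,c'}(Φ_c,Ψ_{c'})`:
* `transportSq` — the TRANSPORT DEFECT `‖S_cΩ_c − S_{c'}Ω_{c'}‖²_{L²(ρ)}` of a fibre profile `Ω` between two slow points;
* ★ `abs_fibrePair_le_of_orth` — if `B_{c',c'}(Ω_{c'}, h) = 0` (fibrewise `K_{c'}`-orthogonality: `Ω_{c'}` the frozen top eigenfunction, `h ⊥ Ω_{c'}`), then
  `|B_{c,c'}(Ω_c, h)| ≤ ‖S_cΩ_c − S_{c'}Ω_{c'}‖·√E_{c'}(h)` — only the transport of the fibre ground state across the kinetic step is seen;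
* ★★ `sq_fibredForm_prod_le_of_orth` — CROSS block (the door's (P4) in model form): with the fibre gap bound `E_c(χ_c) ≤ Λ₁‖χ_c‖²`, a row bound `r`
  of the symmetric slow kernel and a bound `τ(c) ≥ ∫ k(c,c')‖S_cΩ_c − S_{c'}Ω_{c'}‖² dν(c')`: `T(f⊗Ω, χ)² ≤ Λ₁·r·(∫ f²τ dν)·‖χ‖²` for EVERY slow profile `f`
  — the off-diagonal amplitude is ONE transport step (second order in the slow increment `|c − c'| ≍ (L³β)^{-1/2}`, i.e. `O(β^{-1})` against the budget
  `λ_b(L³β)² ≍ β^{-2/3}` of `BORateAll`), and no gap is spent here (the door `innerRateAt_of_bo` spends the stiff gap once, in its completed square);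
* `sq_le_mul_of_forall_am_gm` — the optimisation step `(∀ t>0, |V| ≤ (ta + b/t)/2) ⇒ V² ≤ ab`;
* ★ `integral_prod_mul_eq_zero_of_fibre_orth` — (P1) in model form: `⟨f⊗Ω, χ⟩_{L²(ν⊗π)} = 0` when every fibre of `χ` is `L²(π)`-orthogonal to `Ω_c`.
Integrability side conditions are hypotheses (as in `Literature.Analysis.OperatorTheory.SchurTestKernel`).  HONEST FRAMING: elementary measure theory for
the registered stub of a crux of the CONDITIONAL reduction route to the femto rung R2b1 (RECORD label); the chart supplying `k, s, Ω, Λ₁, τ` for the lattice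
transfer operator is OPEN (route RED lane A C4-CORE + the rate twin); nothing here is infinite volume, a continuum limit or the Clay mass gap.  No named
facts, no `sorry`.

## References
* B. Helffer, *Spectral Theory and its Applications*, CUP 2013, Lemma 7.1 (Schur's test) — [cite: Helffer2013, Lemma 7.1 pp.77–78].
* S. J. Gustafson, I. M. Sigal, *Mathematical Concepts of Quantum Mechanics*, Springer 2003, §12 (Born–Oppenheimer) — [cite: GustafsonSigal2003, §12].
-/

set_option autoImplicit false

noncomputable section

open MeasureTheory

namespace Summit.QuantumFields.YangMills.Theorems.FemtoTransferGap.FibredBO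

variable {C Q Z : Type*} [MeasurableSpace C] [MeasurableSpace Q] [MeasurableSpace Z]
variable {ν : Measure C} {π : Measure Q} {ρ : Measure Z} [SFinite ν] [SFinite π] [SFinite ρ]
variable {k : C → C → ℝ} {s : C → Q → Z → ℝ}

/-! ## CROSS block: fibrewise `K_c`-orthogonality leaves only the transport defect of the fibre profile -/

section Defs₂

variable (π : Measure Q) (ρ : Measure Z) (s : C → Q → Z → ℝ)

/-- Transport defect of the fibre profile `Ω` between the slow points `c, c'`: `‖S_cΩ_c − S_{c'}Ω_{c'}‖²_{L²(ρ)}` — how much the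
(half-transformed) frozen fibre ground state moves across one kinetic step; second order in `c − c'` for smooth families. -/
def transportSq (Ω : C → Q → ℝ) (c c' : C) : ℝ := ∫ z, (halfT π s c (Ω c) z - halfT π s c' (Ω c') z) ^ 2 ∂ρ

end Defs₂

omit [MeasurableSpace C] [SFinite π] [SFinite ρ] in
/-- `0 ≤ ‖S_cΩ_c − S_{c'}Ω_{c'}‖²`. [folklore] -/
theorem transportSq_nonneg (Ω : C → Q → ℝ) (c c' : C) : 0 ≤ transportSq π ρ s Ω c c' :=
  integral_nonneg fun _ => sq_nonneg _

omit [MeasurableSpace C] [SFinite π] [SFinite ρ] in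
/-- `B_{c,c'}(a·h, h') = a·B_{c,c'}(h,h')`. [folklore] -/
theorem fibrePair_const_mul_left (c c' : C) (a : ℝ) (h h' : Q → ℝ) :
    fibrePair π ρ s c c' (fun q => a * h q) h' = a * fibrePair π ρ s c c' h h' := by
  unfold fibrePair
  rw [← integral_const_mul]
  refine integral_congr_ae (ae_of_all _ fun z => ?_)
  dsimp only
  rw [halfT_const_mul]
  ring

omit [MeasurableSpace C] [SFinite π] [SFinite ρ] in
/-- ★ **Fibre cross pairing against a `K_{c'}`-orthogonal fibre function**: if `B_{c',c'}(Ω_{c'}, h) = 0` (e.g. `Ω_{c'}` the frozen top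
eigenfunction of the fibre kernel over `c'` and `h ⊥ Ω_{c'}`), then `|B_{c,c'}(Ω_c, h)| ≤ ‖S_cΩ_c − S_{c'}Ω_{c'}‖·√E_{c'}(h)` — only the TRANSPORT of the
fibre profile from `c'` to `c` is seen. [folklore] -/
theorem abs_fibrePair_le_of_orth (Ω : C → Q → ℝ) (c c' : C) (h : Q → ℝ)
    (hΩc : MemLp (halfT π s c (Ω c)) 2 ρ) (hΩc' : MemLp (halfT π s c' (Ω c')) 2 ρ) (hh : MemLp (halfT π s c' h) 2 ρ)
    (horth : fibrePair π ρ s c' c' (Ω c') h = 0) :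
    |fibrePair π ρ s c c' (Ω c) h| ≤ Real.sqrt (transportSq π ρ s Ω c c') * Real.sqrt (fibreEnergy π ρ s c' h) := by
  have hsub : MemLp (fun z => halfT π s c (Ω c) z - halfT π s c' (Ω c') z) 2 ρ := hΩc.sub hΩc'
  have i1 : Integrable (fun z => (halfT π s c (Ω c) z - halfT π s c' (Ω c') z) * halfT π s c' h z) ρ := hsub.integrable_mul hh
  have i2 : Integrable (fun z => halfT π s c' (Ω c') z * halfT π s c' h z) ρ := hΩc'.integrable_mul hh
  have hsplit : fibrePair π ρ s c c' (Ω c) h =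
      (∫ z, (halfT π s c (Ω c) z - halfT π s c' (Ω c') z) * halfT π s c' h z ∂ρ) + fibrePair π ρ s c' c' (Ω c') h := by
    unfold fibrePair
    calc ∫ z, halfT π s c (Ω c) z * halfT π s c' h z ∂ρ
        = ∫ z, ((halfT π s c (Ω c) z - halfT π s c' (Ω c') z) * halfT π s c' h z + halfT π s c' (Ω c') z * halfT π s c' h z) ∂ρ :=
          integral_congr_ae (ae_of_all _ fun z => by ring)
      _ = (∫ z, (halfT π s c (Ω c) z - halfT π s c' (Ω c') z) * halfT π s c' h z ∂ρ) +
            ∫ z, halfT π s c' (Ω c') z * halfT π s c' h z ∂ρ := integral_add i1 i2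
  rw [hsplit, horth, add_zero]
  exact abs_integral_mul_le_sqrt_mul_sqrt hsub hh

/-- From `|V| ≤ (t·a + t⁻¹·b)/2` for all `t > 0` (`a, b ≥ 0`) to `V² ≤ a·b` (the optimisation step of Schur's test). [cite: Helffer2013, Lemma 7.1 (proof) p.78] -/
theorem sq_le_mul_of_forall_am_gm {V a b : ℝ} (ha : 0 ≤ a) (hb : 0 ≤ b)
    (h : ∀ t : ℝ, 0 < t → |V| ≤ (t * a + t⁻¹ * b) / 2) : V ^ 2 ≤ a * b := by
  by_cases hV : V = 0
  · rw [hV, sq, zero_mul]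
    exact mul_nonneg ha hb
  have hVpos : 0 < |V| := abs_pos.mpr hV
  rcases ha.eq_or_lt with h0 | ha'
  · exfalso
    have hb1 : (0 : ℝ) < b + 1 := by linarith
    have ht : 0 < (b + 1) / |V| := div_pos hb1 hVpos
    have h1 := h _ ht
    rw [← h0, mul_zero, zero_add, inv_div] at h1
    have h2 : |V| / (b + 1) * b ≤ |V| := by
      rw [div_mul_eq_mul_div, div_le_iff₀ hb1]
      nlinarith
    linarith
  · have ht : 0 < |V| / a := div_pos hVpos ha'
    have h1 := h _ ht
    rw [inv_div, div_mul_cancel₀ _ ha'.ne'] at h1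
    have h2 : |V| ≤ a / |V| * b := by linarith
    have h3 : |V| * |V| ≤ a * b := by
      have := mul_le_mul_of_nonneg_right h2 hVpos.le
      calc |V| * |V| ≤ a / |V| * b * |V| := this
        _ = a * b := by field_simp
    calc V ^ 2 = |V| * |V| := by rw [← sq_abs, sq]
      _ ≤ a * b := h3

omit [SFinite ρ] in
/-- ★★ **CROSS block (the door's (P4) in model form)**: let `Ω_c` be fibre profiles that are `K_c`-ORTHOGONAL to the fibres of `χ`
(`B_{c,c}(Ω_c, χ(c,·)) = 0` for every `c` — for the frozen top eigenfunction this is `χ(c,·) ⊥ Ω_c`), let every fibre of `χ` obey the gap bound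
`E_c(χ(c,·)) ≤ Λ₁‖χ(c,·)‖²`, let the symmetric nonnegative slow kernel have row integrals `≤ r`, and let `τ(c)` bound the kinetic average of the transport
defect, `∫ k(c,c')‖S_cΩ_c − S_{c'}Ω_{c'}‖² dν(c') ≤ τ(c)`.  Then for every slow profile `f`:
`T(f⊗Ω, χ)² ≤ Λ₁ · r · (∫ f²τ dν) · ‖χ‖²_{L²(ν⊗π)}` — the off-diagonal amplitude is the size of ONE transport step (second order in the slow increment),
played against nothing: no gap is spent here (the door spends the stiff gap once, in its completed square). [folklore] [cite: Helffer2013, Lemma 7.1 pp.77–78]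
[cite: GustafsonSigal2003, §12] -/
theorem sq_fibredForm_prod_le_of_orth (hk : ∀ c c', 0 ≤ k c c') (hksymm : ∀ c c', k c c' = k c' c) {r Λ₁ : ℝ} (hr : 0 ≤ r) (hΛ₁ : 0 ≤ Λ₁)
    (hrow : ∀ᵐ c ∂ν, ∫ c', k c c' ∂ν ≤ r) (f : C → ℝ) (Ω : C → Q → ℝ) (τ : C → ℝ) {χ : C × Q → ℝ}
    (hΩ : ∀ c, MemLp (halfT π s c (Ω c)) 2 ρ) (hχ : ∀ c, MemLp (halfT π s c fun q => χ (c, q)) 2 ρ)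
    (hχ2 : Integrable (fun x => χ x ^ 2) (ν.prod π)) (hfτ : Integrable (fun c => f c ^ 2 * τ c) ν)
    (hgap : ∀ c, fibreEnergy π ρ s c (fun q => χ (c, q)) ≤ Λ₁ * ∫ q, χ (c, q) ^ 2 ∂π)
    (horth : ∀ c, fibrePair π ρ s c c (Ω c) (fun q => χ (c, q)) = 0)
    (hτ : ∀ c, ∫ c', k c c' * transportSq π ρ s Ω c c' ∂ν ≤ τ c)
    (hI : Integrable (fun p : C × C => k p.1 p.2 * fibrePair π ρ s p.1 p.2 (fun q => f p.1 * Ω p.1 q) (fun q => χ (p.2, q))) (ν.prod ν))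
    (hJ : Integrable (fun p : C × C => k p.1 p.2 * ((|f p.1| * Real.sqrt (transportSq π ρ s Ω p.1 p.2)) *
      Real.sqrt (Λ₁ * ∫ q, χ (p.2, q) ^ 2 ∂π))) (ν.prod ν))
    (hJ₁ : Integrable (fun p : C × C => k p.1 p.2 * transportSq π ρ s Ω p.1 p.2 * f p.1 ^ 2) (ν.prod ν))
    (hJ₂ : Integrable (fun p : C × C => k p.1 p.2 * ∫ q, χ (p.2, q) ^ 2 ∂π) (ν.prod ν)) :
    fibredForm ν π ρ k s (fun x => f x.1 * Ω x.1 x.2) χ ^ 2 ≤ Λ₁ * r * (∫ c, f c ^ 2 * τ c ∂ν) * ∫ x, χ x ^ 2 ∂(ν.prod π) := by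
  -- abbreviations
  set T : C → C → ℝ := fun c c' => transportSq π ρ s Ω c c' with hT
  set m2 : C → ℝ := fun c => ∫ q, χ (c, q) ^ 2 ∂π with hm2
  have hm2nn : ∀ c, 0 ≤ m2 c := fun c => integral_nonneg fun _ => sq_nonneg _
  have hTnn : ∀ c c', 0 ≤ T c c' := fun c c' => transportSq_nonneg Ω c c'
  -- Step A: pointwise bound on the integrand
  have hpt : ∀ p : C × C, |k p.1 p.2 * fibrePair π ρ s p.1 p.2 (fun q => f p.1 * Ω p.1 q) (fun q => χ (p.2, q))| ≤
      k p.1 p.2 * ((|f p.1| * Real.sqrt (T p.1 p.2)) * Real.sqrt (Λ₁ * m2 p.2)) := by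
    intro p
    rw [fibrePair_const_mul_left, abs_mul, abs_of_nonneg (hk p.1 p.2), abs_mul]
    refine mul_le_mul_of_nonneg_left ?_ (hk p.1 p.2)
    have h1 := abs_fibrePair_le_of_orth (π := π) (ρ := ρ) (s := s) Ω p.1 p.2 (fun q => χ (p.2, q)) (hΩ p.1) (hΩ p.2) (hχ p.2) (horth p.2)
    have h2 : Real.sqrt (fibreEnergy π ρ s p.2 fun q => χ (p.2, q)) ≤ Real.sqrt (Λ₁ * m2 p.2) := Real.sqrt_le_sqrt (hgap p.2)
    calc |f p.1| * |fibrePair π ρ s p.1 p.2 (Ω p.1) fun q => χ (p.2, q)|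
        ≤ |f p.1| * (Real.sqrt (T p.1 p.2) * Real.sqrt (fibreEnergy π ρ s p.2 fun q => χ (p.2, q))) :=
          mul_le_mul_of_nonneg_left h1 (abs_nonneg _)
      _ ≤ |f p.1| * (Real.sqrt (T p.1 p.2) * Real.sqrt (Λ₁ * m2 p.2)) :=
          mul_le_mul_of_nonneg_left (mul_le_mul_of_nonneg_left h2 (Real.sqrt_nonneg _)) (abs_nonneg _)
      _ = (|f p.1| * Real.sqrt (T p.1 p.2)) * Real.sqrt (Λ₁ * m2 p.2) := by ring
  -- Step B: |T(fΩ,χ)| ≤ ∫ k (|f|√T) √(Λ₁ m2) over ν ⊗ ν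
  have hB : |fibredForm ν π ρ k s (fun x => f x.1 * Ω x.1 x.2) χ| ≤
      ∫ p, k p.1 p.2 * ((|f p.1| * Real.sqrt (T p.1 p.2)) * Real.sqrt (Λ₁ * m2 p.2)) ∂(ν.prod ν) := by
    unfold fibredForm
    rw [integral_integral hI]
    exact (abs_integral_le_integral_abs).trans (integral_mono hI.abs hJ hpt)
  -- Step C: AM–GM with a parameter, Fubini on each term
  have hA : ∫ p, k p.1 p.2 * T p.1 p.2 * f p.1 ^ 2 ∂(ν.prod ν) ≤ ∫ c, f c ^ 2 * τ c ∂ν := by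
    rw [integral_prod _ hJ₁]
    refine integral_mono_ae hJ₁.integral_prod_left hfτ (ae_of_all _ fun c => ?_)
    dsimp only
    have e : ∫ c', k c c' * T c c' * f c ^ 2 ∂ν = (∫ c', k c c' * T c c' ∂ν) * f c ^ 2 := by
      rw [← integral_mul_const]
    rw [e, mul_comm]
    exact mul_le_mul_of_nonneg_left (hτ c) (sq_nonneg _)
  have hBB : ∫ p, k p.1 p.2 * m2 p.2 ∂(ν.prod ν) ≤ r * ∫ x, χ x ^ 2 ∂(ν.prod π) := by
    rw [integral_prod_symm _ hJ₂]
    have hm : Integrable (fun c' => ∫ c, k c c' * m2 c' ∂ν) ν := hJ₂.swap.integral_prod_left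
    have hm2i : Integrable m2 ν := by
      refine (hχ2.integral_prod_left).congr (ae_of_all _ fun c => ?_)
      rfl
    have hcol : ∀ᵐ c' ∂ν, ∫ c, k c c' ∂ν ≤ r := by
      filter_upwards [hrow] with c' hc'
      have e : (fun c => k c c') = fun c => k c' c := funext fun c => hksymm c c'
      rw [e]
      exact hc'
    calc ∫ c', ∫ c, k c c' * m2 c' ∂ν ∂ν ≤ ∫ c', r * m2 c' ∂ν := by
          refine integral_mono_ae hm (hm2i.const_mul r) ?_
          filter_upwards [hcol] with c' hc'
          rw [integral_mul_const]
          exact mul_le_mul_of_nonneg_right hc' (hm2nn c')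
      _ = r * ∫ c', m2 c' ∂ν := integral_const_mul _ _
      _ = r * ∫ x, χ x ^ 2 ∂(ν.prod π) := by rw [integral_prod _ hχ2]
  have hτnn : ∀ c, 0 ≤ τ c := fun c =>
    (integral_nonneg fun c' => mul_nonneg (hk c c') (hTnn c c')).trans (hτ c)
  have hAnn : 0 ≤ ∫ c, f c ^ 2 * τ c ∂ν := integral_nonneg fun c => mul_nonneg (sq_nonneg _) (hτnn c)
  have hχnn : 0 ≤ ∫ x, χ x ^ 2 ∂(ν.prod π) := integral_nonneg fun _ => sq_nonneg _
  -- the AM–GM bound for every t > 0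
  have hAMGM : ∀ t : ℝ, 0 < t → |fibredForm ν π ρ k s (fun x => f x.1 * Ω x.1 x.2) χ| ≤
      (t * (∫ c, f c ^ 2 * τ c ∂ν) + t⁻¹ * (Λ₁ * (r * ∫ x, χ x ^ 2 ∂(ν.prod π)))) / 2 := by
    intro t ht
    have ht' : 0 < t⁻¹ := inv_pos.mpr ht
    have hpt2 : ∀ p : C × C, k p.1 p.2 * ((|f p.1| * Real.sqrt (T p.1 p.2)) * Real.sqrt (Λ₁ * m2 p.2)) ≤
        (t * (k p.1 p.2 * T p.1 p.2 * f p.1 ^ 2) + t⁻¹ * (Λ₁ * (k p.1 p.2 * m2 p.2))) / 2 := by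
      intro p
      have hx : (|f p.1| * Real.sqrt (T p.1 p.2)) * Real.sqrt (Λ₁ * m2 p.2) ≤
          (t * (|f p.1| * Real.sqrt (T p.1 p.2)) ^ 2 + t⁻¹ * Real.sqrt (Λ₁ * m2 p.2) ^ 2) / 2 := by
        have hsq : 0 ≤ (t * (|f p.1| * Real.sqrt (T p.1 p.2)) - Real.sqrt (Λ₁ * m2 p.2)) ^ 2 := sq_nonneg _
        have e : (t * (|f p.1| * Real.sqrt (T p.1 p.2)) ^ 2 + t⁻¹ * Real.sqrt (Λ₁ * m2 p.2) ^ 2) / 2 -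
            (|f p.1| * Real.sqrt (T p.1 p.2)) * Real.sqrt (Λ₁ * m2 p.2) =
            (t * (|f p.1| * Real.sqrt (T p.1 p.2)) - Real.sqrt (Λ₁ * m2 p.2)) ^ 2 / (2 * t) := by
          field_simp
          ring
        have : 0 ≤ (t * (|f p.1| * Real.sqrt (T p.1 p.2)) - Real.sqrt (Λ₁ * m2 p.2)) ^ 2 / (2 * t) := by positivity
        linarith
      have e1 : (|f p.1| * Real.sqrt (T p.1 p.2)) ^ 2 = T p.1 p.2 * f p.1 ^ 2 := by
        rw [mul_pow, sq_abs, Real.sq_sqrt (hTnn p.1 p.2)]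
        ring
      have e2 : Real.sqrt (Λ₁ * m2 p.2) ^ 2 = Λ₁ * m2 p.2 := Real.sq_sqrt (mul_nonneg hΛ₁ (hm2nn p.2))
      rw [e1, e2] at hx
      have := mul_le_mul_of_nonneg_left hx (hk p.1 p.2)
      calc k p.1 p.2 * ((|f p.1| * Real.sqrt (T p.1 p.2)) * Real.sqrt (Λ₁ * m2 p.2))
          ≤ k p.1 p.2 * ((t * (T p.1 p.2 * f p.1 ^ 2) + t⁻¹ * (Λ₁ * m2 p.2)) / 2) := this
        _ = (t * (k p.1 p.2 * T p.1 p.2 * f p.1 ^ 2) + t⁻¹ * (Λ₁ * (k p.1 p.2 * m2 p.2))) / 2 := by ring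
    have hR : Integrable (fun p : C × C => (t * (k p.1 p.2 * T p.1 p.2 * f p.1 ^ 2) + t⁻¹ * (Λ₁ * (k p.1 p.2 * m2 p.2))) / 2) (ν.prod ν) :=
      ((hJ₁.const_mul t).add ((hJ₂.const_mul Λ₁).const_mul t⁻¹)).div_const 2
    refine hB.trans ((integral_mono hJ hR hpt2).trans ?_)
    rw [integral_div, integral_add (hJ₁.const_mul t) ((hJ₂.const_mul Λ₁).const_mul t⁻¹), integral_const_mul, integral_const_mul,
      integral_const_mul]
    have := add_le_add (mul_le_mul_of_nonneg_left hA ht.le) (mul_le_mul_of_nonneg_left (mul_le_mul_of_nonneg_left hBB hΛ₁) ht'.le)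
    linarith
  -- optimise
  have := sq_le_mul_of_forall_am_gm hAnn (mul_nonneg hΛ₁ (mul_nonneg hr hχnn)) hAMGM
  calc fibredForm ν π ρ k s (fun x => f x.1 * Ω x.1 x.2) χ ^ 2 ≤ (∫ c, f c ^ 2 * τ c ∂ν) * (Λ₁ * (r * ∫ x, χ x ^ 2 ∂(ν.prod π))) := this
    _ = Λ₁ * r * (∫ c, f c ^ 2 * τ c ∂ν) * ∫ x, χ x ^ 2 ∂(ν.prod π) := by ring

/-! ## ORTH: fibrewise orthogonality is exact orthogonality for the product measure -/

/-- ★ **(P1) in model form**: if every fibre of `χ` is `L²(π)`-orthogonal to the fibre profile, `∫ Ω_c(q)χ(c,q)dπ = 0`, then `⟨f⊗Ω, χ⟩_{L²(ν⊗π)} = 0`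
for every slow profile `f` — the adiabatic split is EXACTLY orthogonal for a product a-priori measure (route RED lane A's ★★★ slow disintegration
`integral_configMeasure_slowChart` makes the lattice measure such a product along an equivariant slow chart). [folklore] -/
theorem integral_prod_mul_eq_zero_of_fibre_orth (f : C → ℝ) (Ω : C → Q → ℝ) (χ : C × Q → ℝ)
    (hI : Integrable (fun x : C × Q => f x.1 * Ω x.1 x.2 * χ x) (ν.prod π))
    (horth : ∀ c, ∫ q, Ω c q * χ (c, q) ∂π = 0) :
    ∫ x, f x.1 * Ω x.1 x.2 * χ x ∂(ν.prod π) = 0 := by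
  rw [integral_prod _ hI]
  have h : ∀ c, ∫ q, f c * Ω c q * χ (c, q) ∂π = 0 := by
    intro c
    have e : (fun q => f c * Ω c q * χ (c, q)) = fun q => f c * (Ω c q * χ (c, q)) := funext fun q => by ring
    rw [e, integral_const_mul, horth c, mul_zero]
  simp only [h, integral_zero]

end Summit.QuantumFields.YangMills.Theorems.FemtoTransferGap.FibredBO

end
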